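import Literature.NumberTheory.EllipticCurves.Kato2004.Condition1252NonscalarWitnessProofs
import HarnessLib

/-!
# Serre's lifting lemma at an odd prime with a TORSION-LEVEL witness, WITHOUT the root-of-unity
# hypothesis: `ρ̄_{E,p}` onto + one `τ ∈ Γ_ℚ` trivial on `E[p]` and non-scalar on `E[p²]`
# ⟹ `ρ̄_{E,pⁿ}` onto for all `n`

`Proofs` file (theorems only: no definition, no named fact, debt 0), topic
`NumberTheory/EllipticCurves`, sibling of `Kato2004/TorsionFirstOrderWitnessProofs.lean` (the same
statement WITH the extra hypothesis "`τ` moves a `p²`-th root of unity", which there served the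
unit-trace clause of `WeierstrassCurve.forall_hasSurjectiveModNGaloisRep_of_firstOrderWitness`) and
of `Kato2004/Condition1252NonscalarWitnessProofs.lean` (unit `b2b-bsdres-lit-kato` gen 8: the
trace-free matrix form `WeierstrassCurve.forall_hasSurjectiveModNGaloisRep_of_firstOrderWitness_of_nonscalar`
— `p` odd, `ρ̄_{E,p}` onto, ONE element `≡ 1 + pM₀ (mod p²)` with `M₀ mod p` non-scalar ⟹ the
whole tower; J.-P. Serre, *Abelian ℓ-adic representations and elliptic curves* (1968), IV-23
Lemma 3 and its proof, with "GL₂(𝔽_p) has no abelian quotient of exponent not dividing `2(p−1)`"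
supplying a unit-trace element).

This file restates that witness ON THE TORSION, as in the sibling file but with the `ζ_{p²}`
clause removed:

* `WeierstrassCurve.exists_firstOrderWitness_of_torsion_nonscalar` — a `τ ∈ Γ_ℚ` fixing `E[p]`
  pointwise and NOT acting on `E[p²]` as `Q ↦ (1 + pm) Q` for a single `m` gives, in any
  `ℤ_p`-basis of `T_pE`, `ρ_{E,p}(τ) = 1 + pM₀ + p²V` with `M₀ mod p` non-scalar (the torsion →
  matrix dictionary of the sibling file: `E[pⁿ] = πₙ(T_pE)`, `ker π₁ = pT_pE`);
* `WeierstrassCurve.forall_hasSurjectiveModNGaloisRep_of_fixing_torsion_of_nonscalar` — `p` odd,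
  `ρ̄_{E,p}` onto, such a `τ` ⟹ `ρ̄_{E,pⁿ}` onto for every `n`;
* `WeierstrassCurve.forall_hasSurjectiveModNGaloisRep_three_pow_of_fixing_torsion_of_nonscalar` —
  the `p = 3` binder shape;
* `Kato2004.imageContainsSL2_of_fixing_torsion_of_nonscalar` — hence Kato's (12.5.2).

Why the `ζ`-free form is wanted (cell `bsd-rank1-residual`, team n1011, row T-b9 'tame tower at
`3`'): the witnesses produced by ramification at an ADDITIVE `3` live in `I_𝔓 ∩ ker ρ̄_{E,3}`, and
when `6 ∣ #ρ̄_{E,3}(I_𝔓)` that subgroup need not move `ζ₉`; the good-supersingular argument of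
`Wuthrich2014/ThreeAdicImageSupersingularProofs.lean` §3 (where `#ρ̄_{E,3}(I_𝔓) = 8`) does not
transfer, but the present statement does.

## References

* [SerreAbelianLadic1968] J.-P. Serre, *Abelian ℓ-adic representations and elliptic curves*
  (1968), Ch. IV §3.4, Lemma 3 (IV-23) and its proof.
* [SilvermanAEC2009] J. H. Silverman, *The Arithmetic of Elliptic Curves*, 2nd ed. (2009),
  III.§7 (`T_ℓE`), Prop. III.8.1.
* [Elkies2006] N. D. Elkies, arXiv:math/0612734, Introduction and §1 (why a witness is needed at
  `p = 3`).
* [Kato2004Asterisque] K. Kato, Astérisque 295 (2004), (12.5.2) p. 222.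
-/

noncomputable section

open scoped Classical
open Field

namespace WeierstrassCurve

open Literature.NumberTheory.EllipticCurves Literature.NumberTheory.GaloisRepresentations

variable (W : WeierstrassCurve ℚ) (p : ℕ) [Fact p.Prime]

/-- A non-unit of `ℤ_p` is divisible by `p`. [folklore] -/
private theorem dvd_of_not_isUnit'' {z : ℤ_[p]} (hz : ¬ IsUnit z) : (p : ℤ_[p]) ∣ z := by
  rw [← PadicInt.norm_lt_one_iff_dvd]
  exact lt_of_le_of_ne (PadicInt.norm_le_one z) (fun h ↦ hz (PadicInt.isUnit_iff.mpr h))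

/-- `π_n((p^n) • s) = 0` on the Tate module. [folklore] -/
private theorem proj_pow_smul_eq_zero' (n : ℕ) (s : W.tateModule p) :
    TateModule.proj p n (((p : ℤ_[p]) ^ n) • s) = 0 := by
  rw [TateModule.proj_smul, map_pow, map_natCast, ← Nat.cast_pow, ZMod.natCast_self, ZMod.val_zero,
    zero_smul]

/-- `π₂((p a) • t) = (p · (a mod p²)) • π₂ t` on the Tate module (the component `π₂ t` is
`p²`-torsion). [folklore] -/
private theorem proj_two_p_mul_smul' (a : ℤ_[p]) (t : W.tateModule p) :
    TateModule.proj p 2 (((p : ℤ_[p]) * a) • t) =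
      (p * (PadicInt.toZModPow 2 a).val) • TateModule.proj p 2 t := by
  have hp : p.Prime := Fact.out
  have hlt : p < p ^ 2 := by nlinarith [hp.two_le]
  have hmem := proj_tateModule_mem_geomTorsion W p 2 t
  rw [TateModule.proj_smul, map_mul, map_natCast, ZMod.val_mul, ZMod.val_natCast,
    Nat.mod_eq_of_lt hlt, ← AddSubgroup.torsionBy.mod_self_nsmul' _ hmem]

/-- **A Galois element fixing `E[p]` and non-scalar on `E[p²]` is a first-order element with
non-scalar linear term.**  Let `τ ∈ Γ_ℚ` fix `E[p]` pointwise and suppose `τ` does NOT act on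
`E[p²]` as `Q ↦ (1 + pm) Q` for a single `m ∈ ℕ`.  Then in any `ℤ_p`-basis `b` of `T_pE`,
`ρ_{E,p}(τ) = 1 + p M₀ + p² V` with `M₀ mod p` non-scalar (a unit off-diagonal entry or a unit
difference of diagonal entries).  This is `exists_firstOrderWitness_of_torsion` of the sibling file
with the root-of-unity hypothesis and the unit-trace conclusion both removed (same proof:
`ker π₁ = pT_pE`, and "`M₀ ≡ a (mod p)` scalar" reads "`τ Q = (1 + pa) Q` on `E[p²]`").
[cite: SerreAbelianLadic1968, Ch. IV §3.4, Lemma 3 (IV-23), proof]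
[cite: SilvermanAEC2009, III.§7 and Prop. III.8.1] -/
theorem exists_firstOrderWitness_of_torsion_nonscalar [W.IsElliptic] (τ : absoluteGaloisGroup ℚ)
    (b : Module.Basis (Fin 2) ℤ_[p] (W.tateModule p))
    (h1 : ∀ P ∈ geomTorsion W p, τ • P = P)
    (hns : ¬ ∃ m : ℕ, ∀ Q ∈ geomTorsion W (p ^ 2 : ℕ), τ • Q = (1 + p * m) • Q) :
    ∃ M₀ : Matrix (Fin 2) (Fin 2) ℤ_[p],
      (∃ (τ' : absoluteGaloisGroup ℚ) (V : Matrix (Fin 2) (Fin 2) ℤ_[p]),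
        LinearMap.toMatrix b b (W.galoisRepTate p τ') =
          1 + (p : ℤ_[p]) • M₀ + ((p : ℤ_[p]) ^ 2) • V) ∧
      (IsUnit (M₀ 1 0) ∨ IsUnit (M₀ 0 1) ∨ IsUnit (M₀ 0 0 - M₀ 1 1)) := by
  have hp : p.Prime := Fact.out
  have hp0 : (p : ℚ) ≠ 0 := Nat.cast_ne_zero.mpr hp.ne_zero
  haveI : NeZero (p : ℚ) := ⟨hp0⟩
  set L : W.tateModule p →ₗ[ℤ_[p]] W.tateModule p := W.galoisRepTate p τ with hL
  -- Step 1: `ρ(τ) ≡ 1 (mod p)`: `L (b j) = b j + p • c j`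
  have h0 : ∀ j, TateModule.proj p 1 (L (b j) - b j) = 0 := by
    intro j
    have hmem : TateModule.proj p 1 (b j) ∈ geomTorsion W p := by
      have := proj_tateModule_mem_geomTorsion W p 1 (b j)
      rwa [pow_one] at this
    rw [map_sub, hL, galoisRepTate_apply_apply, TateModule.proj_smul_of_distribMulAction,
      h1 _ hmem, sub_self]
  set c : Fin 2 → W.tateModule p := fun j ↦ TateModule.div (L (b j) - b j) (h0 j) with hc
  have hLb : ∀ j, L (b j) = b j + (p : ℤ_[p]) • c j := by
    intro j
    rw [hc]
    simp only [TateModule.p_smul_div]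
    abel
  set M₀ : Matrix (Fin 2) (Fin 2) ℤ_[p] := Matrix.of fun i j ↦ b.repr (c j) i with hM₀
  have hmat : LinearMap.toMatrix b b L = 1 + (p : ℤ_[p]) • M₀ + ((p : ℤ_[p]) ^ 2) • 0 := by
    ext i j
    rw [smul_zero, add_zero, LinearMap.toMatrix_apply, hLb, map_add, map_smul, Finsupp.add_apply,
      Finsupp.smul_apply, Module.Basis.repr_self, Matrix.add_apply, Matrix.smul_apply,
      Matrix.one_apply, hM₀, Matrix.of_apply, smul_eq_mul, Finsupp.single_apply]
    by_cases hij : i = j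
    · subst hij; simp
    · simp [hij, Ne.symm hij]
  refine ⟨M₀, ⟨τ, 0, hmat⟩, ?_⟩
  -- Step 2: `M₀ mod p` is not scalar, for otherwise `τ` acts on `E[p²]` as `(1 + pa)·`
  by_contra hall
  push Not at hall
  obtain ⟨h10, h01, hdiag⟩ := hall
  obtain ⟨u10, hu10⟩ := dvd_of_not_isUnit'' p h10
  obtain ⟨u01, hu01⟩ := dvd_of_not_isUnit'' p h01
  obtain ⟨ud, hud⟩ := dvd_of_not_isUnit'' p hdiag
  set a : ℤ_[p] := M₀ 1 1 with ha
  set N : Matrix (Fin 2) (Fin 2) ℤ_[p] := !![ud, u01; u10, 0] with hN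
  have hM₀eq : M₀ = a • (1 : Matrix (Fin 2) (Fin 2) ℤ_[p]) + (p : ℤ_[p]) • N := by
    ext i j
    fin_cases i <;> fin_cases j
    · change M₀ 0 0 = _
      have : M₀ 0 0 = a + p * ud := by rw [ha]; linear_combination hud
      simp [hN, this]
    · change M₀ 0 1 = _
      simp [hN, hu01]
    · change M₀ 1 0 = _
      simp [hN, hu10]
    · change M₀ 1 1 = _
      simp [hN, ha]
  -- `L = 1 + (p a) • 1 + p² • (toLin N)`
  have hLeq : L = LinearMap.id + ((p : ℤ_[p]) * a) • LinearMap.id +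
      ((p : ℤ_[p]) ^ 2) • Matrix.toLin b b N := by
    have h := congrArg (Matrix.toLin b b) hmat
    rw [Matrix.toLin_toMatrix, smul_zero, add_zero, hM₀eq] at h
    rw [h, map_add, map_smul, Matrix.toLin_one, map_add, map_smul, map_smul, Matrix.toLin_one,
      smul_add, smul_smul, smul_smul, ← pow_two]
    simp only [add_assoc]
  apply hns
  refine ⟨(PadicInt.toZModPow 2 a).val, fun Q hQ ↦ ?_⟩
  obtain ⟨t, ht⟩ := proj_surjective_of_isAlgClosed_holds W p 2 hQ
  have key : TateModule.proj p 2 (L t) = τ • Q := by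
    rw [hL, galoisRepTate_apply_apply, TateModule.proj_smul_of_distribMulAction, ht]
  rw [hLeq, LinearMap.add_apply, LinearMap.add_apply, LinearMap.smul_apply, LinearMap.smul_apply,
    LinearMap.id_apply, map_add, map_add, proj_two_p_mul_smul', proj_pow_smul_eq_zero', add_zero,
    ht] at key
  rw [← key, add_smul, one_smul]

/-- **The tower from surj(p) and a torsion-level witness, no root-of-unity clause** (`p` odd): if
`ρ̄_{E,p}` is onto and some `τ ∈ Γ_ℚ` fixes `E[p]` pointwise and is not a scalar `(1 + pm)·` on
`E[p²]`, then `ρ̄_{E,pⁿ}` is onto for every `n`.  Serre's lifting lemma IV-23 with the base step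
supplied by the witness (`exists_firstOrderWitness_of_torsion_nonscalar`) through the trace-free
form `forall_hasSurjectiveModNGaloisRep_of_firstOrderWitness_of_nonscalar` (no unit-trace element
is asked of `τ`: one is manufactured from surj(p) there).
[cite: SerreAbelianLadic1968, Ch. IV §3.4, Lemma 3 (IV-23)] [cite: Elkies2006, Introduction (p. 1) and §1] -/
theorem forall_hasSurjectiveModNGaloisRep_of_fixing_torsion_of_nonscalar [W.IsElliptic]
    (hp2 : p ≠ 2) (hsurj : W.HasSurjectiveModNGaloisRep p) (τ : absoluteGaloisGroup ℚ)
    (h1 : ∀ P ∈ geomTorsion W p, τ • P = P)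
    (hns : ¬ ∃ m : ℕ, ∀ Q ∈ geomTorsion W (p ^ 2 : ℕ), τ • Q = (1 + p * m) • Q) (n : ℕ) :
    W.HasSurjectiveModNGaloisRep (p ^ n : ℕ) := by
  have hp : p.Prime := Fact.out
  have hp0 : (p : ℚ) ≠ 0 := Nat.cast_ne_zero.mpr hp.ne_zero
  haveI : Module.Free ℤ_[p] (W.tateModule p) := module_free_tateModule_holds W p
  haveI : Module.Finite ℤ_[p] (W.tateModule p) := module_finite_tateModule_holds W p
  let b : Module.Basis (Fin 2) ℤ_[p] (W.tateModule p) :=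
    Module.finBasisOfFinrankEq ℤ_[p] (W.tateModule p) (finrank_tateModule_eq_two_holds W p hp0)
  obtain ⟨M₀, hM₀, hns'⟩ := W.exists_firstOrderWitness_of_torsion_nonscalar p τ b h1 hns
  exact forall_hasSurjectiveModNGaloisRep_of_firstOrderWitness_of_nonscalar hp2 hsurj b M₀ hM₀ hns' n

/-- The same at `p = 3`, in the binder shape `∀ n, W.HasSurjectiveModNGaloisRep (3 ^ n)` of the
tree's `p = 3` readings (Wuthrich 2014 Lemma 20; the cell's `towerSurj` bit; Kato's (12.5.2) via
`Kato2004.imageContainsSL2_iff_forall_hasSurjectiveModNGaloisRep`): surj(3) and ONE `τ ∈ Γ_ℚ`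
trivial on `E[3]` and not a scalar `(1 + 3m)·` on `E[9]` give the `3`-adic tower.
[cite: SerreAbelianLadic1968, Ch. IV §3.4, Lemma 3 (IV-23)] [cite: Elkies2006, Introduction (p. 1) and §1] -/
theorem forall_hasSurjectiveModNGaloisRep_three_pow_of_fixing_torsion_of_nonscalar [W.IsElliptic]
    (hsurj : W.HasSurjectiveModNGaloisRep 3) (τ : absoluteGaloisGroup ℚ)
    (h1 : ∀ P ∈ geomTorsion W 3, τ • P = P)
    (hns : ¬ ∃ m : ℕ, ∀ Q ∈ geomTorsion W 9, τ • Q = (1 + 3 * m) • Q) (n : ℕ) :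
    W.HasSurjectiveModNGaloisRep (3 ^ n : ℕ) := by
  haveI : Fact (Nat.Prime 3) := ⟨Nat.prime_three⟩
  refine W.forall_hasSurjectiveModNGaloisRep_of_fixing_torsion_of_nonscalar 3 (by norm_num) hsurj τ
    h1 ?_ n
  simpa using hns

end WeierstrassCurve

namespace Literature.NumberTheory.EllipticCurves

open WeierstrassCurve

/-- **Kato's (12.5.2) from surj(p) and a torsion-level witness, no root-of-unity clause** (`p`
odd): `ρ̄_{E,p}` onto and one `τ ∈ Γ_ℚ` trivial on `E[p]`, not a scalar `(1 + pm)·` on `E[p²]`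
⟹ the image of `Gal(ℚ̄/ℚ(ζ_{p^∞}))` in `Aut(T_pE)` contains `SL₂(ℤ_p)`
(`Kato2004.imageContainsSL2_iff_forall_hasSurjectiveModNGaloisRep`).
[cite: Kato2004Asterisque, (12.5.2) (p. 222)] [cite: SerreAbelianLadic1968, Ch. IV §3.4, Lemma 3 (IV-23)] -/
theorem Kato2004.imageContainsSL2_of_fixing_torsion_of_nonscalar (W : WeierstrassCurve ℚ)
    [W.IsElliptic] (p : ℕ) [Fact p.Prime] (hp2 : p ≠ 2) (hsurj : W.HasSurjectiveModNGaloisRep p)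
    (τ : Field.absoluteGaloisGroup ℚ) (h1 : ∀ P ∈ geomTorsion W p, τ • P = P)
    (hns : ¬ ∃ m : ℕ, ∀ Q ∈ geomTorsion W (p ^ 2 : ℕ), τ • Q = (1 + p * m) • Q) :
    Kato2004.ImageContainsSL2 W p :=
  (Kato2004.imageContainsSL2_iff_forall_hasSurjectiveModNGaloisRep W p).mpr
    (W.forall_hasSurjectiveModNGaloisRep_of_fixing_torsion_of_nonscalar p hp2 hsurj τ h1 hns)

end Literature.NumberTheory.EllipticCurves

end
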